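import Literature.AlgebraicGeometry.Resolution.HasseSchmidtDualExistence
import Literature.AlgebraicGeometry.Resolution.HasseSystemOfFormallySmooth
import Literature.AlgebraicGeometry.Resolution.DiffOpCoordinateSpan
import Literature.AlgebraicGeometry.Resolution.SmoothCoordinates
import HarnessLib

/-!
# Truncated Hasse–Schmidt systems along ANY minimal system of generators of the maximal ideal of a
# local algebra essentially of finite type and formally smooth over a perfect field (EGA IV₄ 16.11.2, assembled)

Topic: `Literature/AlgebraicGeometry/Resolution`. ASSEMBLY of tree facts, no new mathematics: for `k` a perfect
field and `R` a LOCAL `k`-algebra, essentially of finite type and formally smooth over `k` (e.g. `A_𝔫` or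
`𝒪_{X,x}` for `A`/`X` smooth over `k`), and for EVERY family `u : ι → R` minimally generating `𝔪_R`
(`(u) = 𝔪`, `|ι| = emb dim R`; when `R` is regular: every regular system of parameters), and every truncation
level `n`, there are `k`-linear maps `Δ_q : R → R` (`q ∈ ℕ^ι`) with

* `Δ_0 = id` and the higher Leibniz rule `Δ_q(fg) = Σ_{q₁+q₂=q} Δ_{q₁} f · Δ_{q₂} g` for `|q| ≤ n`;
* the EXACT divided-power values on monomials in `u`: `Δ_q(u^β) = (∏_{i ∈ supp q} (β_i choose q_i)) · u^{β−q}`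
  for `|q| ≤ n` (so `Δ_β u^β = 1`, `Δ_q u^β = 0` for `q ≰ β`);
* each `Δ_q`, `|q| ≤ d ≤ n`, is a differential operator of order `≤ d` in Grothendieck's sense (the tree's
  `IsDiffOpLE k d`), hence lowers the `𝔪`-adic (indeed any `I`-adic) order by at most `d`.

Ingredients: `formallySmooth_mvPolynomial_of_span_eq_maximalIdeal` (`HasseSchmidtDualExistence.lean`: `R` is
formally smooth over `k[X_ι] → R`, `X_i ↦ u_i`; Matsumura 30.6/28.7), `formallySmooth_residueField_of_perfectField`
(`SmoothCoordinates.lean`), `exists_hasseSystem_of_formallySmooth_eval` (`HasseSystemOfFormallySmooth.lean`: the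
Taylor lifting `R → R[t]/(t)^{n+1}` along `X_i ↦ u_i + t_i`), `isDiffOpLE_of_hasseSystem`
(`DiffOpCoordinateSpan.lean`) and `IsDiffOpLE.apply_mem_pow_sub` (`DifferentialOperators.lean`). This is the
«partial differential operators `∂_{x^J}` with respect to a regular system of parameters» setting of H. Kawanoue,
Publ. RIMS 43 (2007), Ch. 4 (arXiv:math/0607009 chunk p0085 L17, p0086 L32: «Given a regular system of parameters
`(x_1, …, x_d)`, we have the corresponding partial differential operators `∂_{x_i^u}`»), which the campaign
`res-hironaka` (D-0089) needs for the Coefficient Lemma 4.1.4.1 (brick (a) of `HOME/lit/res-lit-2/SIZING-IFP-Ch4.md`);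
nothing of H. Hironaka's 2017 manuscript is referred to or asserted.

## References

* [EGAIV4] A. Grothendieck, J. Dieudonné, ÉGA IV₄, Publ. Math. IHÉS 32 (1967), Thm. 16.11.2, Prop. 17.2.3.
* [Matsumura1987] H. Matsumura, *Commutative Ring Theory* (1986), §27, Thm. 30.6 (ii).
* [Kawanoue2007] H. Kawanoue, Publ. RIMS 43 (2007) 819–909 = arXiv:math/0607009, Ch. 4 setting (p0085 L17, p0086 L32).
-/

noncomputable section

namespace Literature.AlgebraicGeometry.Resolution

open IsLocalRing

universe u v w

section RegularParameters

variable {k : Type u} {R : Type v} [Field k] [PerfectField k] [CommRing R] [IsLocalRing R]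
  [Algebra k R] [Algebra.EssFiniteType k R] [Algebra.FormallySmooth k R]

/-- **Truncated Hasse–Schmidt systems along any minimal system of generators of `𝔪`** (EGA IV₄ 16.11.2 at a
point with formally smooth residue field): `R` local, essentially of finite type and formally smooth over the
perfect field `k`, `u : ι → R` with `(u) = 𝔪_R` and `|ι| = emb dim R`. For every `n` there are `k`-linear
`Δ_q : R → R`, `q ∈ ℕ^ι`, with `Δ_0 = id`, the higher Leibniz rule for `|q| ≤ n`, the exact values
`Δ_q(u^β) = (∏_{i ∈ supp q} (β_i choose q_i)) u^{β−q}` for `|q| ≤ n`, and `Δ_q ∈ Diff^{≤ d}_{R/k}` for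
`|q| ≤ d ≤ n`. [cite: EGAIV4, Thm. 16.11.2] -/
theorem exists_hasseSystem_of_span_eq_maximalIdeal {ι : Type w} [Fintype ι] [DecidableEq ι]
    (u : ι → R) (hu : Ideal.span (Set.range u) = maximalIdeal R)
    (hcard : Fintype.card ι = (maximalIdeal R).spanFinrank) (n : ℕ) :
    ∃ Δ : (ι →₀ ℕ) → (R →ₗ[k] R),
      (∀ b, Δ 0 b = b) ∧
      (∀ q : ι →₀ ℕ, q.degree ≤ n →
        ∀ f g : R, Δ q (f * g) = ∑ p ∈ Finset.antidiagonal q, Δ p.1 f * Δ p.2 g) ∧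
      (∀ q β : ι →₀ ℕ, q.degree ≤ n →
        Δ q (∏ i, u i ^ β i) = ((∏ i ∈ q.support, (β i).choose (q i) : ℕ) : R) * ∏ i, u i ^ (β - q) i) ∧
      (∀ (d : ℕ) (q : ι →₀ ℕ), q.degree ≤ d → d ≤ n → IsDiffOpLE k d (Δ q)) := by
  letI alg : Algebra (MvPolynomial ι k) R := (MvPolynomial.aeval u).toRingHom.toAlgebra
  haveI : IsScalarTower k (MvPolynomial ι k) R := IsScalarTower.of_algebraMap_eq fun c => by
    change algebraMap k R c = MvPolynomial.aeval u (algebraMap k (MvPolynomial ι k) c)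
    rw [AlgHom.commutes]
  haveI : Algebra.FormallySmooth k (ResidueField R) :=
    formallySmooth_residueField_of_perfectField (k := k) (A := R)
  haveI : Algebra.FormallySmooth (MvPolynomial ι k) R :=
    formallySmooth_mvPolynomial_of_span_eq_maximalIdeal (k := k) u hu hcard
  have halg : ∀ i, algebraMap (MvPolynomial ι k) R (MvPolynomial.X i) = u i := fun i => by
    change MvPolynomial.aeval u (MvPolynomial.X i) = u i
    rw [MvPolynomial.aeval_X]
  obtain ⟨Δ, h0, hmul, hval⟩ := exists_hasseSystem_of_formallySmooth_eval k (B := R) (ι := ι) n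
  refine ⟨Δ, h0, hmul, fun q β hq => ?_, fun d q hq hdn => isDiffOpLE_of_hasseSystem k h0 hmul d q hq hdn⟩
  have := hval q β hq
  simp only [halg] at this
  exact this

omit [PerfectField k] [IsLocalRing R] [Algebra.EssFiniteType k R] [Algebra.FormallySmooth k R] in
/-- The members of such a system lower the `I`-adic order by at most `|q|`, for every ideal `I`:
`f ∈ I^m ⇒ Δ_q f ∈ I^{m − |q|}` (`|q| ≤ n`). [cite: EGAIV4, Thm. 16.11.2] -/
theorem hasseSystem_apply_mem_pow_sub {ι : Type w} {Δ : (ι →₀ ℕ) → (R →ₗ[k] R)} {n : ℕ}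
    (hΔ : ∀ (d : ℕ) (q : ι →₀ ℕ), q.degree ≤ d → d ≤ n → IsDiffOpLE k d (Δ q))
    {q : ι →₀ ℕ} (hq : q.degree ≤ n) (I : Ideal R) {m : ℕ} {f : R} (hf : f ∈ I ^ m) :
    Δ q f ∈ I ^ (m - q.degree) :=
  (hΔ q.degree q le_rfl hq).apply_mem_pow_sub I m hf

end RegularParameters

end Literature.AlgebraicGeometry.Resolution

end
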